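import Summits.CriticalPhenomena.PercolationContinuityZ3.Theorems.FK.OSSSMonotonicMeasures
import Literature.Probability.Percolation.OneArmOSSSCovariance
import HarnessLib

/-!
# The one-arm OSSS variance inequality for a MONOTONIC measure on the edges of a finite labelled graph
# (Duminil-Copin–Raoufi–Tassion 2019, Lemma 3.2 for one seed set)

Claimed R42 (8)(c) in the cell INBOX at 2026-08-28T02:11:55Z by fkp-10a gen 352 (NEW CLAIM #2 of the gen), addressed to coordinator fk-4 g266 (seated 01:27Z 2026-08-28; R146 l.8252: row FO-10a-g352 = package g352-osss; its (κ) clause sends the FK instantiation to a new claim, R147); lineage row FO-10a-g352f (self-suggested), package g352-fkosss, label FS-A.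
Support file of the `fk-continuity` cell (lineage fkp-10a, `--supports stmt-CriticalPhenomena-4575`); builds on
p205010 (kernel theorem, internal audit signed; external expert review pending).  No definitions, no named facts,
no sorries; standard axioms.  Package `g352-fkosss` = THE FK INSTANTIATION of the OSSS inequality for monotonic measures
(row FO-10a-g352 `g352-osss`): Duminil-Copin–Raoufi–Tassion's Theorem 1.2 (sharpness of the random-cluster phase
transition on `ℤ^d`, `q ≥ 1`) and, on `ℤ²`, `p_c(q) = √q/(1+√q)`.  UNCONDITIONAL; nothing here touches FH / TP_FK / the
`_r3` binders of the cell.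

Setting: a finite edge-labelled graph (`W`, `E`, symmetric incidence `edge : W → W → Option E`) as in the tree's
`SeedExploration.lean`; a source `o`, targets `B`, one seed set `Z` separating `o` from `B`
(`SeedExploration.Separates`); a strictly positive probability weight `μ` on `E → Bool` with the FKG lattice condition.
With `A = μ(o ↔ B) = Σ_y μ(y) 𝟙{o ↔ B}(y)` and any majorant `R(e) ≥ μ(a₀ ↔ Z) + μ(b₀ ↔ Z)` of the revealment of the
label `e` carried by the pair `{a₀, b₀}`,

  `A(1 − A) ≤ Σ_e R(e) · Cov_μ(𝟙{o ↔ B}, ω_e)`     (`variance_le_sum_majorant_mul_cov`).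

This is the monotonic-measure version of the tree's product-measure `SeedExploration.variance_le_sum_revealment_mul_piv`:
the OSSS inequality for monotonic measures (`MonotonicOSSS.cov_le_sum_revealment_mul_cov`, package `g352-osss`) applied to
the seed-exploration tree of `Z` with `{0,1}`-valued leaf labels (`(label + 1)/2`), its halting correctness
`label_eq_of_halt`, the revealment hook `seedConn_of_query`, and FKG (`Cov_μ(𝟙{o ↔ B}, ω_e) ≥ 0`, Mathlib `fkg`) to pass from
the revealment to the majorant.  Summation over spheres `Z = ∂Λ_k` and the lattice bookkeeping are done in the companion
files.  Finite sums only; no definitions.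

## References
* H. Duminil-Copin, A. Raoufi, V. Tassion, Ann. of Math. 189 (2019) 75–99, §3 Lemma 3.2 and its proof.
  [DuminilCopinRaoufiTassion2019]
* R. O'Donnell, M. Saks, O. Schramm, R. Servedio, FOCS 2005, Thm 3.2. [OdonnellEtAl2005]
-/

namespace Summit.CriticalPhenomena.PercolationContinuityZ3.Theorems.FK

namespace MonotonicOSSS

open Finset Function Literature.Probability.ODonnellSaksSchrammServedio2005
open Literature.Probability.ODonnellSaksSchrammServedio2005.Strategy
open Literature.Probability.Percolation Literature.Probability.Percolation.GhostExploration
open Literature.Probability.Percolation.SeedExploration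

variable {W E : Type*} {edge : W → W → Option E}

/-- `𝟙{o ↔ B}` is increasing in the configuration. [cite: DuminilCopinRaoufiTassion2019, §3 Lemma 3.2 (𝟙_{0↔∂Λ_n} is increasing)] -/
theorem garm_monotone (o : W) (B : Set W) : Monotone (garm edge o B) := by
  intro y y' hyy'
  have hmono : Conn edge o B y → Conn edge o B y' := by
    rintro ⟨b, hb, hr⟩
    exact ⟨b, hb, yReach_mono (fun e he => Bool.le_iff_imp.1 (hyy' e) he) hr⟩
  unfold garm
  by_cases h : Conn edge o B y
  · rw [if_pos h, if_pos (hmono h)]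
  · rw [if_neg h]; split_ifs <;> norm_num

/-- `0 ≤ 𝟙{o ↔ B} ≤ 1`. [cite: DuminilCopinRaoufiTassion2019, §3 Lemma 3.2 (𝟙_{0↔∂Λ_n} is Boolean)] -/
theorem garm_mem_unit (o : W) (B : Set W) (y : E → Bool) : 0 ≤ garm edge o B y ∧ garm edge o B y ≤ 1 := by
  unfold garm; split_ifs <;> norm_num

variable [Fintype E] [DecidableEq E]

/-- The seed-exploration tree of `Z` with `{0,1}`-valued leaf labels `(label + 1)/2` COMPUTES `𝟙{o ↔ B}` when `Z` separates
`o` from `B` (halting correctness `label_eq_of_halt`). [cite: DuminilCopinRaoufiTassion2019, §3 proof of Lemma 3.2 (T determines 𝟙_{0↔∂Λ_n})] -/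
theorem eval_seedTree_eq_garm (hsymm : ∀ a b, edge a b = edge b a) {Z : Set W} {o : W} {B : Set W}
    (hsep : Separates edge Z o B) (y : E → Bool) :
    (tree (strategy edge Z) (fun σ => (label edge Z o B σ + 1) / 2)).eval y = garm edge o B y :=
  eval_tree_eq (strategy_legal (edge := edge) Z) (fun σ x hc hh => by
    rw [label_eq_of_halt hsymm hsep σ x hc hh, SeedExploration.gpm_eq]; ring) y

open Classical in
/-- REVEALMENT OF THE SEED TREE UNDER ANY NONNEGATIVE WEIGHT: if the label `e` is carried by at most the pair `{a₀, b₀}`, then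
`μ(e queried) ≤ μ(a₀ ↔ Z) + μ(b₀ ↔ Z)` (an edge is queried only when one endpoint is already joined to the seeds).
[cite: DuminilCopinRaoufiTassion2019, §3 proof of Lemma 3.2 (δ_e(T) ≤ μ[u↔∂Λ_k] + μ[v↔∂Λ_k])] -/
theorem sum_queried_le_seedConn (μ : (E → Bool) → ℝ) (hμ0 : ∀ y, 0 ≤ μ y) (Z : Set W) (L : (E → Option Bool) → ℝ)
    (e : E) (a₀ b₀ : W) (hends : ∀ a b, edge a b = some e → a = a₀ ∨ a = b₀) :
    ∑ y, μ y * (if e ∈ (tree (strategy edge Z) L).queried y then 1 else 0)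
      ≤ (∑ y, μ y * (if SeedConn edge Z y a₀ then 1 else 0)) + ∑ y, μ y * (if SeedConn edge Z y b₀ then 1 else 0) := by
  classical
  rw [← Finset.sum_add_distrib]
  refine Finset.sum_le_sum fun y _ => ?_
  rw [← mul_add]
  refine mul_le_mul_of_nonneg_left ?_ (hμ0 y)
  by_cases hq : e ∈ (tree (strategy edge Z) L).queried y
  · obtain ⟨σ', hc, hS⟩ := exists_of_mem_queried (strategy edge Z) L _ (fun i b h => by simp at h) hq
    obtain ⟨a, b, hab, hg⟩ := seedConn_of_query hc hS
    rw [if_pos hq]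
    rcases hends a b hab with rfl | rfl
    · rw [if_pos hg]; split_ifs <;> norm_num
    · rw [if_pos hg]; split_ifs <;> norm_num
  · rw [if_neg hq]; split_ifs <;> norm_num

open Classical in
/-- **THE ONE-ARM OSSS VARIANCE INEQUALITY FOR A MONOTONIC MEASURE.**  `μ` a strictly positive probability weight on
`E → Bool` with the FKG lattice condition; `Z` separates `o` from `B`; every label `e` is carried by at most one pair
`{a₀, b₀}` with `μ(a₀ ↔ Z) + μ(b₀ ↔ Z) ≤ R(e)`.  Then, with `A = Σ_y μ(y) 𝟙{o ↔ B}(y)`,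
`A(1 − A) ≤ Σ_e R(e) · (Σ_y μ(y) 𝟙{o ↔ B}(y) 𝟙{y_e} − A · Σ_y μ(y) 𝟙{y_e})`.
[cite: DuminilCopinRaoufiTassion2019, §3 Lemma 3.2 (proof: Thm 1.1 for the tree of ∂Λ_k, δ_e ≤ μ[u↔∂Λ_k] + μ[v↔∂Λ_k])] -/
theorem variance_le_sum_majorant_mul_cov (hsymm : ∀ a b, edge a b = edge b a) (μ : (E → Bool) → ℝ)
    (hμ0 : ∀ y, 0 < μ y) (hμ : ∀ a b, μ a * μ b ≤ μ (a ⊓ b) * μ (a ⊔ b)) (hμ1 : ∑ y, μ y = 1)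
    {Z : Set W} {o : W} {B : Set W} (hsep : Separates edge Z o B) (R : E → ℝ)
    (hR : ∀ e, ∃ a₀ b₀, (∀ a b, edge a b = some e → a = a₀ ∨ a = b₀) ∧
      (∑ y, μ y * (if SeedConn edge Z y a₀ then 1 else 0)) + (∑ y, μ y * (if SeedConn edge Z y b₀ then 1 else 0)) ≤ R e) :
    (∑ y, μ y * garm edge o B y) * (1 - ∑ y, μ y * garm edge o B y)
      ≤ ∑ e, R e * ((∑ y, μ y * (garm edge o B y * if y e = true then 1 else 0))
          - (∑ y, μ y * garm edge o B y) * (∑ y, μ y * if y e = true then 1 else 0)) := by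
  set T := tree (strategy edge Z) (fun σ => (label edge Z o B σ + 1) / 2) with hT
  have hev : ∀ y, T.eval y = garm edge o B y := eval_seedTree_eq_garm hsymm hsep
  have hred : T.Reduced := reduced_build (strategy_legal (edge := edge) Z) _ _ _
  have hF : ∀ y, 0 ≤ T.eval y ∧ T.eval y ≤ 1 := fun y => by rw [hev]; exact garm_mem_unit o B y
  have key := cov_le_sum_revealment_mul_cov μ hμ0 hμ hμ1 T hred hF (garm edge o B)
    (fun y => (garm_mem_unit o B y).1) (garm_monotone o B)
  simp only [hev, garm_mul_self, one_mul] at key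
  -- each covariance is nonnegative (FKG), each revealment is below its majorant
  have hcov : ∀ e, 0 ≤ (∑ y, μ y * (garm edge o B y * if y e = true then 1 else 0))
      - (∑ y, μ y * garm edge o B y) * (∑ y, μ y * if y e = true then 1 else 0) := fun e => by
    have h := fkg (garm edge o B) (fun y => if y e = true then (1 : ℝ) else 0) μ (fun y => (hμ0 y).le)
      (fun y => (garm_mem_unit o B y).1) (fun y => by positivity) (garm_monotone o B) (monotone_ite_apply e) hμ
    rw [hμ1, one_mul] at h
    exact sub_nonneg.2 h
  have hdel : ∀ e, ∑ y, μ y * (if e ∈ T.queried y then 1 else 0) ≤ R e := fun e => by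
    obtain ⟨a₀, b₀, hends, hle⟩ := hR e
    exact (sum_queried_le_seedConn μ (fun y => (hμ0 y).le) Z _ e a₀ b₀ hends).trans hle
  calc (∑ y, μ y * garm edge o B y) * (1 - ∑ y, μ y * garm edge o B y)
      = (∑ y, μ y * garm edge o B y) - (∑ y, μ y * garm edge o B y) * (∑ y, μ y * garm edge o B y) := by ring
    _ ≤ ∑ e, (∑ y, μ y * (if e ∈ T.queried y then 1 else 0)) * ((∑ y, μ y * (garm edge o B y * if y e = true then 1 else 0))
          - (∑ y, μ y * garm edge o B y) * (∑ y, μ y * if y e = true then 1 else 0)) := key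
    _ ≤ _ := Finset.sum_le_sum fun e _ => mul_le_mul_of_nonneg_right (hdel e) (hcov e)

end MonotonicOSSS

end Summit.CriticalPhenomena.PercolationContinuityZ3.Theorems.FK
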